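import Literature.LinearAlgebra.Matrix.RankMinors
import Mathlib.Topology.Semicontinuity.Basic
import Mathlib.Topology.Algebra.Group.Matrix
import Mathlib.Topology.Instances.Matrix
import Literature.NumberTheory.Automorphic.ParabolicBruhatCellsGL
import HarnessLib

/-!
# Corner ranks: the invariants of the parabolic double cosets `P_c \ GL_n / P_{c'}`

First structural input of the Geometrical Lemma for `GL_n` (Bernstein–Zelevinsky 1977, 2.11–2.12;
Casselman 1995, §6.3): the stratification of `G = GL_n(F)` by the double cosets `P_c x P_{c'}`
of two standard parabolic subgroups and its topology ("`G_w` is open in `G`", "the intersection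
of `G_R` with the closure of `C(x)`, `x` minimal, is `C(x)` itself, which is therefore closed in
`G_R`", Casselman 1995, p. 55). For `GL_n` the double cosets are classified by **corner ranks**:
for a row labelling `c : Fin n → α`, a column labelling `c' : Fin n → β` (linear orders) and
thresholds `k : α`, `l : β`,

  `cornerRank c c' k l g = rank` of the submatrix of `g` on the rows `{i | k ≤ c i}` and the
  columns `{j | c' j ≤ l}` (the lower-left corner).

This file proves the properties of these invariants which the support filtration of induced
representations consumes:

* (rank via minors: the tree's `Literature.LinearAlgebra.Matrix.le_rank_iff_exists_det_submatrix_ne_zero`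
  of `RankMinors` — `m ≤ rank M` iff some `m × m` minor of `M` is non-zero);
* `cornerRank_parabolic_mul`, `cornerRank_mul_parabolic` — **invariance** under left
  multiplication by `P_c` and right multiplication by `P_{c'}` (block triangular matrices act on
  the corner through an invertible triangular block; the row half is
  `submatrix_mul_of_blockTriangular` / `isUnit_det_submatrix_of_mem_standardParabolicGL` of
  `ParabolicBruhatCellsGL`, which treats the one-sided cosets `P_c \ GL_n / U_n`);
* `isOpen_setOf_le_cornerRank` — `{g | m ≤ cornerRank … g}` is open in `GL_n(F)` for a
  topological field `F` with `{0}` closed (a non-vanishing minor), i.e. corner ranks are lower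
  semicontinuous (`lowerSemicontinuous_cornerRank`); hence the total corner rank is lower
  semicontinuous (`lowerSemicontinuous_totalCornerRank`), the sets `{m ≤ total}` form a
  decreasing family of open bi-invariant sets, and each fibre of the corner-rank vector is
  relatively open and relatively closed in its level set of the total rank
  (`cornerRankFibre_eq_inter_levelSet`, `isOpen_…`, `isClosed_…`).

Pure linear algebra / topology; two definitions (`cornerRank`, `totalCornerRank`), theorems
otherwise; no named facts.

## References

* I. N. Bernstein, A. V. Zelevinsky, *Induced representations of reductive `p`-adic groups I*,
  Ann. Sci. ÉNS (4) 10 (1977), 1.5, 2.11–2.12 (the geometry of `P \ G / Q`).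
  [BernsteinZelevinsky1977]
* W. Casselman, *Introduction to the theory of admissible representations of `p`-adic reductive
  groups* (draft 1 May 1995), §1.3 and §6.3, p. 55. [Casselman1995]
-/

noncomputable section

open scoped MatrixGroups
open Matrix

namespace Literature.NumberTheory.Automorphic

/-! ### Corner ranks -/

section Defs

variable {K : Type*} [Field K] {n : ℕ} {α β : Type*} [LinearOrder α] [LinearOrder β]

/-- The **corner rank** `ρ_{k,l}(g)`: the rank of the submatrix of `g` on the rows `{i | k ≤ c i}`
and the columns `{j | c' j ≤ l}` (the lower-left corner determined by the thresholds `k`, `l` of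
the row labelling `c` and the column labelling `c'`). (Bernstein–Zelevinsky 1977, 2.11–2.12;
Casselman 1995, §6.3.) [folklore] -/
def cornerRank (c : Fin n → α) (c' : Fin n → β) (k : α) (l : β) (g : Matrix (Fin n) (Fin n) K) :
    ℕ :=
  (g.submatrix (Subtype.val : {i // k ≤ c i} → Fin n) (Subtype.val : {j // c' j ≤ l} → Fin n)).rank

variable [Fintype α] [Fintype β]

/-- The **total corner rank** `|ρ|(g) = Σ_{k,l} ρ_{k,l}(g)`. [folklore] -/
def totalCornerRank (c : Fin n → α) (c' : Fin n → β) (g : Matrix (Fin n) (Fin n) K) : ℕ :=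
  ∑ kl : α × β, cornerRank c c' kl.1 kl.2 g

end Defs

/-! ### Invariance under the two parabolics -/

section Invariance

variable {K : Type*} [Field K] {n : ℕ} {α β : Type*} [LinearOrder α] [LinearOrder β]
  (c : Fin n → α) (c' : Fin n → β)

/-- Dually, block upper triangular matrices preserve the span of the left columns: for `q` block
triangular with respect to `c'`, the columns `{c' ≤ l}` of `g q` are those of
`g|^{c' ≤ l} · q|_{c' ≤ l}`. [folklore] -/
theorem submatrix_mul_of_blockTriangular_right {q : Matrix (Fin n) (Fin n) K}
    (hq : q.BlockTriangular c') (g : Matrix (Fin n) (Fin n) K) (l : β) {ι : Type*} (e : ι → Fin n) :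
    (g * q).submatrix e (Subtype.val : {j // c' j ≤ l} → Fin n) =
      g.submatrix e (Subtype.val : {j // c' j ≤ l} → Fin n) *
        q.submatrix (Subtype.val : {j // c' j ≤ l} → Fin n)
          (Subtype.val : {j // c' j ≤ l} → Fin n) := by
  ext i j
  simp only [submatrix_apply, mul_apply]
  symm
  rw [← Finset.sum_subtype (Finset.univ.filter fun t : Fin n => c' t ≤ l)
    (by intro t; simp only [Finset.mem_filter, Finset.mem_univ, true_and])
    (fun t => g (e i) t * q t j)]
  refine Finset.sum_filter_of_ne fun t _ ht => ?_
  by_contra hlt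
  apply ht
  rw [hq (lt_of_le_of_lt j.2 (not_le.1 hlt)), mul_zero]

/-- The diagonal block `q|_{c' ≤ l}` of an invertible block triangular `q` is invertible.
[folklore] -/
theorem isUnit_det_submatrix_cols_of_mem (q : GL (Fin n) K) (hq : q ∈ standardParabolicGL K c')
    (l : β) :
    IsUnit ((q : Matrix (Fin n) (Fin n) K).submatrix (Subtype.val : {j // c' j ≤ l} → Fin n)
      (Subtype.val : {j // c' j ≤ l} → Fin n)).det := by
  have hqinv : ((q⁻¹ : GL (Fin n) K) : Matrix (Fin n) (Fin n) K).BlockTriangular c' :=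
    (standardParabolicGL K c').inv_mem hq
  have h := submatrix_mul_of_blockTriangular_right c' (ι := {j // c' j ≤ l}) hqinv
    ((q : GL (Fin n) K) : Matrix (Fin n) (Fin n) K) l Subtype.val
  rw [← Units.val_mul, mul_inv_cancel, Units.val_one,
    submatrix_one _ Subtype.val_injective] at h
  exact IsUnit.of_mul_eq_one _ (by rw [← det_mul, ← h, det_one])

/-- **Left invariance**: `ρ_{k,l}(p g) = ρ_{k,l}(g)` for `p ∈ P_c`.
(Bernstein–Zelevinsky 1977, 1.5; Casselman 1995, §1.3.) [folklore] -/
theorem cornerRank_parabolic_mul {p : GL (Fin n) K} (hp : p ∈ standardParabolicGL K c)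
    (g : Matrix (Fin n) (Fin n) K) (k : α) (l : β) :
    cornerRank c c' k l ((p : Matrix (Fin n) (Fin n) K) * g) = cornerRank c c' k l g := by
  unfold cornerRank
  rw [submatrix_mul_of_blockTriangular c hp g k]
  exact rank_mul_eq_right_of_isUnit_det _ _ (isUnit_det_submatrix_of_mem_standardParabolicGL c hp k)

/-- **Right invariance**: `ρ_{k,l}(g q) = ρ_{k,l}(g)` for `q ∈ P_{c'}`.
(Bernstein–Zelevinsky 1977, 1.5; Casselman 1995, §1.3.) [folklore] -/
theorem cornerRank_mul_parabolic {q : GL (Fin n) K} (hq : q ∈ standardParabolicGL K c')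
    (g : Matrix (Fin n) (Fin n) K) (k : α) (l : β) :
    cornerRank c c' k l (g * (q : Matrix (Fin n) (Fin n) K)) = cornerRank c c' k l g := by
  unfold cornerRank
  rw [submatrix_mul_of_blockTriangular_right c' hq g l]
  exact rank_mul_eq_left_of_isUnit_det _ _ (isUnit_det_submatrix_cols_of_mem c' q hq l)

variable [Fintype α] [Fintype β]

/-- The total corner rank is bi-invariant: `|ρ|(p g q) = |ρ|(g)` for `p ∈ P_c`, `q ∈ P_{c'}`.
[folklore] -/
theorem totalCornerRank_parabolic_mul_mul_parabolic {p q : GL (Fin n) K}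
    (hp : p ∈ standardParabolicGL K c) (hq : q ∈ standardParabolicGL K c')
    (g : Matrix (Fin n) (Fin n) K) :
    totalCornerRank c c' ((p : Matrix (Fin n) (Fin n) K) * g * (q : Matrix (Fin n) (Fin n) K)) =
      totalCornerRank c c' g := by
  unfold totalCornerRank
  refine Finset.sum_congr rfl fun kl _ => ?_
  rw [cornerRank_mul_parabolic c c' hq, cornerRank_parabolic_mul c c' hp]

end Invariance

/-! ### Lower semicontinuity and the open filtration -/

section Topology

variable {K : Type*} [Field K] [TopologicalSpace K] [IsTopologicalRing K] [T1Space K]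
  {n : ℕ} {α β : Type*} [LinearOrder α] [LinearOrder β] (c : Fin n → α) (c' : Fin n → β)

/-- **`{g | m ≤ ρ_{k,l}(g)}` is open in `GL_n(K)`** (a non-vanishing `m × m` minor, for `K` a
topological field in which points are closed). (Casselman 1995, §6.3, p. 55: "`G_w` is open in
`G`".) [folklore] -/
theorem isOpen_setOf_le_cornerRank (k : α) (l : β) (m : ℕ) :
    IsOpen {g : GL (Fin n) K | m ≤ cornerRank c c' k l (g : Matrix (Fin n) (Fin n) K)} := by
  have hset : {g : GL (Fin n) K | m ≤ cornerRank c c' k l (g : Matrix (Fin n) (Fin n) K)} =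
      ⋃ f : Fin m → {i // k ≤ c i}, ⋃ e : Fin m → {j // c' j ≤ l},
        {g : GL (Fin n) K | ((g : Matrix (Fin n) (Fin n) K).submatrix (Subtype.val ∘ f)
          (Subtype.val ∘ e)).det ≠ 0} := by
    ext g
    simp only [Set.mem_setOf_eq, cornerRank,
      Literature.LinearAlgebra.Matrix.le_rank_iff_exists_det_submatrix_ne_zero,
      submatrix_submatrix, Set.mem_iUnion]
  rw [hset]
  refine isOpen_iUnion fun f => isOpen_iUnion fun e => ?_
  exact isOpen_ne.preimage
    ((Units.continuous_val.matrix_submatrix (Subtype.val ∘ f) (Subtype.val ∘ e)).matrix_det)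

/-- **Corner ranks are lower semicontinuous** on `GL_n(K)`. [folklore] -/
theorem lowerSemicontinuous_cornerRank (k : α) (l : β) :
    LowerSemicontinuous fun g : GL (Fin n) K =>
      cornerRank c c' k l (g : Matrix (Fin n) (Fin n) K) := by
  rw [lowerSemicontinuous_iff_isOpen_preimage]
  intro m
  have h : (fun g : GL (Fin n) K => cornerRank c c' k l (g : Matrix (Fin n) (Fin n) K)) ⁻¹'
      Set.Ioi m = {g : GL (Fin n) K |
        m + 1 ≤ cornerRank c c' k l (g : Matrix (Fin n) (Fin n) K)} := by
    ext g; exact Nat.lt_iff_add_one_le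
  rw [h]
  exact isOpen_setOf_le_cornerRank c c' k l (m + 1)

variable [Fintype α] [Fintype β]

/-- The total corner rank is lower semicontinuous. [folklore] -/
theorem lowerSemicontinuous_totalCornerRank :
    LowerSemicontinuous fun g : GL (Fin n) K =>
      totalCornerRank c c' (g : Matrix (Fin n) (Fin n) K) :=
  lowerSemicontinuous_sum fun kl _ => lowerSemicontinuous_cornerRank c c' kl.1 kl.2

/-- **The open filtration**: `{g | m ≤ |ρ|(g)}` is open in `GL_n(K)` (and decreasing in `m`,
bi-invariant under `P_c × P_{c'}` by `totalCornerRank_parabolic_mul_mul_parabolic`).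
(Casselman 1995, §6.3, the open sets `G_n`.) [cite: Casselman1995, §6.3, p. 55] -/
theorem isOpen_setOf_le_totalCornerRank (m : ℕ) :
    IsOpen {g : GL (Fin n) K | m ≤ totalCornerRank c c' (g : Matrix (Fin n) (Fin n) K)} := by
  rcases m with _ | m
  · simp only [zero_le, Set.setOf_true, isOpen_univ]
  · have h : {g : GL (Fin n) K | m + 1 ≤ totalCornerRank c c' (g : Matrix (Fin n) (Fin n) K)} =
        (fun g : GL (Fin n) K => totalCornerRank c c' (g : Matrix (Fin n) (Fin n) K)) ⁻¹'
          Set.Ioi m := by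
      ext g; exact Nat.lt_iff_add_one_le.symm
    rw [h]
    exact (lowerSemicontinuous_totalCornerRank c c').isOpen_preimage m

/-- `{g | ∀ k l, ρ k l ≤ ρ_{k,l}(g)}` is open. [folklore] -/
theorem isOpen_setOf_forall_le_cornerRank (ρ : α × β → ℕ) :
    IsOpen {g : GL (Fin n) K | ∀ kl : α × β,
      ρ kl ≤ cornerRank c c' kl.1 kl.2 (g : Matrix (Fin n) (Fin n) K)} := by
  have h : {g : GL (Fin n) K | ∀ kl : α × β,
      ρ kl ≤ cornerRank c c' kl.1 kl.2 (g : Matrix (Fin n) (Fin n) K)} =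
        ⋂ kl : α × β, {g : GL (Fin n) K |
          ρ kl ≤ cornerRank c c' kl.1 kl.2 (g : Matrix (Fin n) (Fin n) K)} := by
    ext g; simp only [Set.mem_setOf_eq, Set.mem_iInter]
  rw [h]
  exact isOpen_iInter_of_finite fun kl => isOpen_setOf_le_cornerRank c c' kl.1 kl.2 (ρ kl)

omit [Fintype α] [Fintype β] in
/-- `{g | ∀ k l, ρ_{k,l}(g) ≤ ρ k l}` is closed. [folklore] -/
theorem isClosed_setOf_forall_cornerRank_le (ρ : α × β → ℕ) :
    IsClosed {g : GL (Fin n) K | ∀ kl : α × β,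
      cornerRank c c' kl.1 kl.2 (g : Matrix (Fin n) (Fin n) K) ≤ ρ kl} := by
  have h : {g : GL (Fin n) K | ∀ kl : α × β,
      cornerRank c c' kl.1 kl.2 (g : Matrix (Fin n) (Fin n) K) ≤ ρ kl} =
        ⋂ kl : α × β, {g : GL (Fin n) K |
          ρ kl + 1 ≤ cornerRank c c' kl.1 kl.2 (g : Matrix (Fin n) (Fin n) K)}ᶜ := by
    ext g
    simp only [Set.mem_setOf_eq, Set.mem_iInter, Set.mem_compl_iff, not_le, Nat.lt_add_one_iff]
  rw [h]
  exact isClosed_iInter fun kl =>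
    (isOpen_setOf_le_cornerRank c c' kl.1 kl.2 (ρ kl + 1)).isClosed_compl

omit [TopologicalSpace K] [IsTopologicalRing K] [T1Space K] in
/-- **The fibres of the corner-rank vector inside a level set of the total rank.** On the level
set `{|ρ| = Σ ρ}` the fibre `{ρ(g) = ρ}` is cut out by the *open* conditions `ρ k l ≤ ρ_{k,l}(g)`
(if all corner ranks are at least the `ρ k l` and the totals agree, they are equal).
[folklore] -/
theorem cornerRankFibre_eq_open_inter_levelSet (ρ : α × β → ℕ) :
    {g : GL (Fin n) K | ∀ kl : α × β,
        cornerRank c c' kl.1 kl.2 (g : Matrix (Fin n) (Fin n) K) = ρ kl} =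
      {g : GL (Fin n) K | ∀ kl : α × β,
          ρ kl ≤ cornerRank c c' kl.1 kl.2 (g : Matrix (Fin n) (Fin n) K)} ∩
        {g : GL (Fin n) K | totalCornerRank c c' (g : Matrix (Fin n) (Fin n) K) = ∑ kl, ρ kl} := by
  ext g
  simp only [Set.mem_setOf_eq, Set.mem_inter_iff, totalCornerRank]
  constructor
  · intro h
    exact ⟨fun kl => (h kl).ge, Finset.sum_congr rfl fun kl _ => h kl⟩
  · rintro ⟨hle, hsum⟩
    have h := (Finset.sum_eq_sum_iff_of_le fun kl _ => hle kl).1 hsum.symm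
    exact fun kl => (h kl (Finset.mem_univ kl)).symm

omit [TopologicalSpace K] [IsTopologicalRing K] [T1Space K] in
/-- Dually, on the level set the fibre is cut out by the *closed* conditions `ρ_{k,l}(g) ≤ ρ k l`.
[folklore] -/
theorem cornerRankFibre_eq_closed_inter_levelSet (ρ : α × β → ℕ) :
    {g : GL (Fin n) K | ∀ kl : α × β,
        cornerRank c c' kl.1 kl.2 (g : Matrix (Fin n) (Fin n) K) = ρ kl} =
      {g : GL (Fin n) K | ∀ kl : α × β,
          cornerRank c c' kl.1 kl.2 (g : Matrix (Fin n) (Fin n) K) ≤ ρ kl} ∩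
        {g : GL (Fin n) K | totalCornerRank c c' (g : Matrix (Fin n) (Fin n) K) = ∑ kl, ρ kl} := by
  ext g
  simp only [Set.mem_setOf_eq, Set.mem_inter_iff, totalCornerRank]
  constructor
  · intro h
    exact ⟨fun kl => (h kl).le, Finset.sum_congr rfl fun kl _ => h kl⟩
  · rintro ⟨hle, hsum⟩
    have h := (Finset.sum_eq_sum_iff_of_le fun kl _ => hle kl).1 hsum
    exact fun kl => h kl (Finset.mem_univ kl)

/-- **Strata are relatively open in their level set** (Casselman 1995, §6.3: `C(x)`, `x` minimal,
is open in the closed set where the total rank is fixed). [cite: Casselman1995, §6.3, p. 55] -/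
theorem exists_isOpen_cornerRankFibre_eq_inter (ρ : α × β → ℕ) :
    ∃ U : Set (GL (Fin n) K), IsOpen U ∧
      {g : GL (Fin n) K | ∀ kl : α × β,
          cornerRank c c' kl.1 kl.2 (g : Matrix (Fin n) (Fin n) K) = ρ kl} =
        U ∩ {g : GL (Fin n) K | totalCornerRank c c' (g : Matrix (Fin n) (Fin n) K) = ∑ kl, ρ kl} :=
  ⟨_, isOpen_setOf_forall_le_cornerRank c c' ρ, cornerRankFibre_eq_open_inter_levelSet c c' ρ⟩

/-- **Strata are relatively closed in their level set** (Casselman 1995, §6.3: "the intersection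
of `G_R` with the closure of `C(x)` … is `C(x)` itself, which is therefore closed in `G_R`").
[cite: Casselman1995, §6.3, p. 55] -/
theorem exists_isClosed_cornerRankFibre_eq_inter (ρ : α × β → ℕ) :
    ∃ Z : Set (GL (Fin n) K), IsClosed Z ∧
      {g : GL (Fin n) K | ∀ kl : α × β,
          cornerRank c c' kl.1 kl.2 (g : Matrix (Fin n) (Fin n) K) = ρ kl} =
        Z ∩ {g : GL (Fin n) K | totalCornerRank c c' (g : Matrix (Fin n) (Fin n) K) = ∑ kl, ρ kl} :=
  ⟨_, isClosed_setOf_forall_cornerRank_le c c' ρ, cornerRankFibre_eq_closed_inter_levelSet c c' ρ⟩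

end Topology

end Literature.NumberTheory.Automorphic
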